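import Summits.BirchSwinnertonDyer.BirchSwinnertonDyer.Theorems.SylvesterTwoHeegnerIndexCoupledUpperBoundReductionSeven
import Summits.BirchSwinnertonDyer.BirchSwinnertonDyer.Theorems.SylvesterTwoHeegnerIndexUpperOfPartsPlusHSY
import Summits.BirchSwinnertonDyer.BirchSwinnertonDyer.Theorems.SylvesterTwoHeegnerIndexTwoAdicPairHSYOfFactsPlusOfThmC
import Summits.BirchSwinnertonDyer.BirchSwinnertonDyer.Theorems.SylvesterTwoHeegnerIndexLowerSplit
import Summits.BirchSwinnertonDyer.BirchSwinnertonDyer.Theorems.CMRungInputs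
import HarnessLib

/-!
# Route `SylvesterTwoHeegnerIndex` (rung K7t): the HAND ITEM 19229 `HeegnerIndexUpperAtTwoHSY` and the
# rung leaf `X12.CMAtTwo` BY NAME from the line's TYPED RESIDUALS (VARIANT J) — composition only

Cell `bsd-cm`, seat `bsd-cm-k7t-c2` (prover-bsd-cm-k7t-c2-g15-0; D-0074 hand «find: 19229»). PARTITION
(D-0054): CornerF at `p = 2` (B14/O12) × 𝒞_HSY (`E_p : x³ + y³ = p`, `p ≡ 4, 7 (9)`, `3 ∉ 𝔽_p^{×3}`)
× `p = 2` — states-the-residual-of (closes no cell and no item; moves no label; BSD is not claimed).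
Kernel record `--supports stmt-BirchSwinnertonDyer-19229` (CONDITIONAL theorems: the gate records
`proof.conditional`, credits nothing).

WHAT THIS FILE RECORDS. After ROAD (k) (line card `Cruxes/UpperOffV0HSYPlus/Lines/cmframe-kolyvagin2.md`,
skeleton of record VARIANT J `Cruxes/UpperOffV0HSYPlus/Lines/coupled_variantJ.lean`, planner D325) the
honest kernel reading of the hand item is ONE composition of LANDED glue, displayed here once so that
the cell, the referee and the director can cite a single declaration:

* `heegnerIndexUpperAtTwoHSY_of_facts_of_thmC_of_coupledUpperBounds` — **the fact-free UPPER hand item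
  19229 BY NAME ⟸ `PublishedFactsTwoPlus` (19724, published inputs) + THEOREM C
  `HSYPointTwoDivisibleSevenModNine` (19802; cell theorem on PAPER, refereed memo two v2.6; kernel OPEN)
  + `CoupledUpperBoundAtTwoFourModNine` (THEOREM K3 typed, p563747; PAPER, refereed g61; kernel OPEN)
  + `CoupledUpperBoundAtTwoSevenModNine` (THEOREM K3* typed, p566195; PAPER CANDIDATE, desk (M-K3-7);
  kernel OPEN)** — through K3R-7's splice `upperOffV0HSYPlus_of_coupledUpperBounds` (crux 19804 by name),
  the closed glue 19805 `heegnerIndexUpperOfPartsPlusHSY_proof`, the closed 19803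
  `twoAdicPairHSYOfFactsPlusOfThmC_proof`, and the literal identity «19725 = `PublishedFactsTwoPlus` →
  19229». So «find: 19229» IS, in the kernel, exactly these three displayed `Prop`s beyond the published
  facts — two Euler-system statements at `p = 2` for `ℤ[ω]`-CM (K3, K3*) and one explicit CM-point
  `2`-divisibility (THEOREM C); nothing else.
* `heegnerIndexLowerAtTwoHSY_of_facts_of_onV0_of_offV0` — the LOWER hand item 19230 (k7t-c3's) BY NAME
  ⟸ `PublishedFactsTwo` + `LowerOnV0HSY` (19891) + `LowerOffV0HSY` (19892), by the term of the closed
  glue 19893 (`SylvesterTwoLowerSplit.lowerOfFacts_of_onV0_of_offV0`, p471972).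
* `cmAtTwo_of_residuals` — **the rung leaf `X12.CMAtTwo` (`BSD(E_p, 2)` on 𝒞_HSY) BY NAME ⟸
  `PublishedFactsTwoPlus` + THEOREM C + K3 typed + K3* typed + `LowerOnV0HSY` + `LowerOffV0HSY`**, through
  the term of the closed Assembly 19232 (the Theses-free bridge `CMRungInputs.cmAtTwo_of_inputs`,
  p406906): the COMPLETE residual list of rung K7t in one signature — every hypothesis a named tree
  `Prop`, none inlined, none attacked here. (Imports re-pointed to the route-independent modules
  `…LowerSplit` / `CMRungInputs` per the gate's `lint.theses-cone` hint; statements unchanged.)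

HONEST READING. Reformulation by composition; nothing is decided for any `p`; B14 = O12 stays OPEN AS A
CLASS. The three upper residuals are paper theorems / candidates of the cell (memo two §15 THM C, §64–§66
THM K3, §67–§68 THM K3*), each facts-conditional; the two lower residuals are the main-conjecture
direction at the inert prime `2` (Kolyvagin's conjecture for the HSY system; nothing in print).

References: Hu–Shu–Yin, JLMS 100 (2019) Thm. 1.3/1.4, Cor. 4.4; Gross–Zagier (1986) I.6.5; Kolyvagin
(1990) Thm. A; McCallum, LMS LN 153 (1991) §5 Thm. 5.4; cell memos as cited in the imported files.
-/

set_option autoImplicit false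
set_option linter.dupNamespace false

namespace Summit.BirchSwinnertonDyer.BirchSwinnertonDyer.Theorems.SylvesterTwoHandItemResiduals

open Summit.BirchSwinnertonDyer.BirchSwinnertonDyer.Theses.SylvesterTwoHeegnerIndex
open Summit.BirchSwinnertonDyer.BirchSwinnertonDyer.Theorems
open Summit.BirchSwinnertonDyer.BirchSwinnertonDyer.Theorems.SylvesterTwoCoupledUpperBound

/-- The facts-plus UPPER parent 19725 `HeegnerIndexUpperAtTwoHSYOfFactsPlus` BY NAME from THEOREM C and
the two typed coupled bounds (K3, K3*): glue 19805 ∘ (closed 19803, K3R-7 splice). Composition only;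
CONDITIONAL on the three displayed `Prop`s. [cite: HuShuYin2019, Cor. 4.4 and (bsd) p. 12]
[cite: McCallumLMS1991, Thm. 5.4] -/
theorem heegnerIndexUpperAtTwoHSYOfFactsPlus_of_thmC_of_coupledUpperBounds
    (hT : HSYPointTwoDivisibleSevenModNine) (hK4 : CoupledUpperBoundAtTwoFourModNine)
    (hK7 : CoupledUpperBoundAtTwoSevenModNine) : HeegnerIndexUpperAtTwoHSYOfFactsPlus :=
  heegnerIndexUpperOfPartsPlusHSY_proof hT twoAdicPairHSYOfFactsPlusOfThmC_proof
    (upperOffV0HSYPlus_of_coupledUpperBounds hK4 hK7)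

/-- **THE HAND ITEM 19229 `HeegnerIndexUpperAtTwoHSY` (fact-free UPPER half on 𝒞_HSY) BY NAME ⟸
`PublishedFactsTwoPlus` + THEOREM C + THEOREM K3 typed + THEOREM K3* typed.** (19725 is literally
`PublishedFactsTwoPlus → HeegnerIndexUpperAtTwoHSY`.) CONDITIONAL; credits nothing; the three displayed
`Prop`s are OPEN in the kernel (paper: refereed / refereed / candidate). This is the complete list of
what «find: 19229» now hinges on. [cite: HuShuYin2019, Cor. 4.4 and (bsd) p. 12]
[cite: Kolyvagin1990, Thm. A] [cite: McCallumLMS1991, Thm. 5.4] -/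
theorem heegnerIndexUpperAtTwoHSY_of_facts_of_thmC_of_coupledUpperBounds
    (hF : PublishedFactsTwoPlus) (hT : HSYPointTwoDivisibleSevenModNine)
    (hK4 : CoupledUpperBoundAtTwoFourModNine) (hK7 : CoupledUpperBoundAtTwoSevenModNine) :
    HeegnerIndexUpperAtTwoHSY :=
  heegnerIndexUpperAtTwoHSYOfFactsPlus_of_thmC_of_coupledUpperBounds hT hK4 hK7 hF

/-- The LOWER hand item 19230 `HeegnerIndexLowerAtTwoHSY` BY NAME ⟸ `PublishedFactsTwo` + `LowerOnV0HSY`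
(19891) + `LowerOffV0HSY` (19892), by the term of the closed glue 19893 (19477 is literally
`PublishedFactsTwo → HeegnerIndexLowerAtTwoHSY`). CONDITIONAL; both children are OPEN (main-conjecture direction at `2`).
[cite: HuShuYin2019, Thm. 1.4 and Thm. 1.6 (2)] [cite: GrossZagier1986, Thm. I.6.3] -/
theorem heegnerIndexLowerAtTwoHSY_of_facts_of_onV0_of_offV0 (hF : PublishedFactsTwo)
    (hon : LowerOnV0HSY) (hoff : LowerOffV0HSY) : HeegnerIndexLowerAtTwoHSY :=
  SylvesterTwoLowerSplit.lowerOfFacts_of_onV0_of_offV0 hon hoff hF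

/-- **THE RUNG LEAF `X12.CMAtTwo` (`BSD(E_p, 2)` on 𝒞_HSY) BY NAME from the COMPLETE RESIDUAL LIST of rung
K7t:** `PublishedFactsTwoPlus` (published inputs) + THEOREM C (19802) + THEOREM K3 typed + THEOREM K3*
typed + `LowerOnV0HSY` (19891) + `LowerOffV0HSY` (19892), by the term of the closed Assembly 19232
(`CMRungInputs.cmAtTwo_of_inputs`). Every
hypothesis is a named tree `Prop`; CONDITIONAL; nothing decided; B14 = O12 open as a class; BSD is not
claimed for any curve. [cite: GrossZagier1986, V.§2 (pp. 310–312)] [cite: HuShuYin2019, Thm. 1.4 (p. 3)]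
[cite: McCallumLMS1991, Thm. 5.4] -/
theorem cmAtTwo_of_residuals (hF : PublishedFactsTwoPlus) (hT : HSYPointTwoDivisibleSevenModNine)
    (hK4 : CoupledUpperBoundAtTwoFourModNine) (hK7 : CoupledUpperBoundAtTwoSevenModNine)
    (hon : LowerOnV0HSY) (hoff : LowerOffV0HSY) :
    _root_.Summit.BirchSwinnertonDyer.Rank1Residual.X12.CMAtTwo :=
  _root_.Summit.BirchSwinnertonDyer.BirchSwinnertonDyer.Rank1Residual.CMRungInputs.cmAtTwo_of_inputs
    (heegnerIndexLowerAtTwoHSY_of_facts_of_onV0_of_offV0 hF.1 hon hoff)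
    (heegnerIndexUpperAtTwoHSY_of_facts_of_thmC_of_coupledUpperBounds hF hT hK4 hK7) hF.1

end Summit.BirchSwinnertonDyer.BirchSwinnertonDyer.Theorems.SylvesterTwoHandItemResiduals
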